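import Mathlib.Analysis.Convex.Deriv
import Mathlib.Analysis.SpecialFunctions.Exp
import Mathlib.Topology.MetricSpace.Pseudo.Lemmas
import Literature.Analysis.SpecialFunctions.LaguerreSoninEnvelope
import Literature.Analysis.SpecialFunctions.LaguerreZeros
import HarnessLib

/-!
# The Szegő normal form `w = e^{-t²/2} tⁿ L_d^{(n-1/2)}(t²)`: decay, convexity off the oscillatory
# interval, and the sign pattern between its zeros

Sequel of `LaguerreSoninEnvelope.lean` (normal form `w″ + Q w = 0`). Elementary facts used by
`LaguerreSoninTestPoints.lean`:

* `continuous_laguerreNormal`, `tendsto_laguerreNormal_atTop` (`w → 0` at `+∞`: Gaussian factor);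
* `convexOn_mul_laguerreNormal`: `σ·w` is convex on any interval where `Q · (σw) ≤ 0`
  (`(σw)″ = -Q σ w ≥ 0`) — the mechanism of Szegő Thm. 6.31.2 (no zeros where `Q < 0`);
* with the tree's factorisation `L_d^{(n-1/2)} = ((-1)^d/d!) ∏ (X - rᵢ)`, `0 < r₀ < ⋯ < r_{d-1}`
  (`laguerre_eq_C_mul_prod_pos_roots`, `LaguerreZeros.lean`): `w(√rᵢ) = 0` and the SIGN PATTERN
  `(-1)^j w(t) > 0` on the `j`-th gap (`laguerreNormal_gap_sign`, via `sign_prod_sub`).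

## References
* [Szego1975] G. Szegő, *Orthogonal Polynomials*, 4th ed. (1975), (5.1.2), (5.1.6), Thm. 3.3.1, Thm. 6.31.2.
-/

noncomputable section

open Polynomial Set
open scoped Nat

namespace Literature.Analysis.SpecialFunctions

variable (n d : ℕ)


/-! ### Continuity and decay of the normal form -/

/-- `w` is continuous on `ℝ`. [cite: Szego1975, (5.1.2)] -/
theorem continuous_laguerreNormal : Continuous (laguerreNormal n d) := by
  unfold laguerreNormal
  exact ((Real.continuous_exp.comp (by fun_prop)).mul (continuous_pow n)).mul
    ((laguerre ((n : ℝ) - 1 / 2) d).continuous.comp (continuous_pow 2))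

/-- `e^{-t²/2} tᵐ → 0` as `t → ∞` (since `e^{-t²/2} ≤ e^{1/2} e^{-t}`). [folklore] -/
private theorem tendsto_exp_neg_sq_half_mul_pow (m : ℕ) :
    Filter.Tendsto (fun t : ℝ => Real.exp (-(t ^ 2 / 2)) * t ^ m) Filter.atTop (nhds 0) := by
  have hg : Filter.Tendsto (fun t : ℝ => Real.exp (1 / 2) * (t ^ m * Real.exp (-t))) Filter.atTop
      (nhds 0) := by
    simpa using (Real.tendsto_pow_mul_exp_neg_atTop_nhds_zero m).const_mul (Real.exp (1 / 2))
  refine squeeze_zero' (Filter.eventually_atTop.2 ⟨0, fun t ht => by positivity⟩)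
    (Filter.eventually_atTop.2 ⟨0, fun t ht => ?_⟩) hg
  have h1 : Real.exp (-(t ^ 2 / 2)) ≤ Real.exp (1 / 2) * Real.exp (-t) := by
    rw [← Real.exp_add]
    exact Real.exp_le_exp.2 (by nlinarith [sq_nonneg (t - 1)])
  calc Real.exp (-(t ^ 2 / 2)) * t ^ m ≤ Real.exp (1 / 2) * Real.exp (-t) * t ^ m :=
        mul_le_mul_of_nonneg_right h1 (pow_nonneg ht m)
    _ = Real.exp (1 / 2) * (t ^ m * Real.exp (-t)) := by ring

/-- **`w(t) → 0` as `t → ∞`** (Gaussian factor against polynomial growth). [cite: Szego1975, (5.1.2)] -/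
theorem tendsto_laguerreNormal_atTop :
    Filter.Tendsto (laguerreNormal n d) Filter.atTop (nhds 0) := by
  have hrepr : laguerreNormal n d = fun t => ∑ k ∈ Finset.range (d + 1),
      laguerreCoeff ((n : ℝ) - 1 / 2) d k * (Real.exp (-(t ^ 2 / 2)) * t ^ (n + 2 * k)) := by
    funext t
    rw [laguerreNormal, eval_laguerre, Finset.mul_sum]
    refine Finset.sum_congr rfl fun k _ => ?_
    rw [pow_add, pow_mul]; ring
  rw [hrepr]
  have h := tendsto_finsetSum (Finset.range (d + 1)) fun k _ =>
    (tendsto_exp_neg_sq_half_mul_pow (n + 2 * k)).const_mul (laguerreCoeff ((n : ℝ) - 1 / 2) d k)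
  simpa using h

/-! ### Convexity of `σ·w` where `Q·(σw) ≤ 0` -/

/-- If `Q(t)·σw(t) ≤ 0` on the interior of a convex set `S ⊆ (0, ∞)` (closure points allowed only at
the ends), then `σ w` is convex on `S`: `(σw)″ = -Q σ w ≥ 0`. [cite: Szego1975, Thm. 6.31.2] -/
theorem convexOn_mul_laguerreNormal {S : Set ℝ} (hS : Convex ℝ S) (hint : interior S ⊆ Ioi 0)
    (hcont : ContinuousOn (fun t => laguerreNormal n d t) S) (σ : ℝ)
    (hsign : ∀ t ∈ interior S, laguerreNormalQ n d t * (σ * laguerreNormal n d t) ≤ 0) :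
    ConvexOn ℝ S (fun t => σ * laguerreNormal n d t) := by
  have hder : ∀ t ∈ interior S, HasDerivAt (fun t => σ * laguerreNormal n d t)
      (σ * laguerreNormalDeriv n d t) t := fun t ht =>
    (hasDerivAt_laguerreNormal n d (ne_of_gt (hint ht))).const_mul σ
  have hder2 : ∀ t ∈ interior S, HasDerivAt (fun t => σ * laguerreNormalDeriv n d t)
      (σ * (-(laguerreNormalQ n d t) * laguerreNormal n d t)) t := fun t ht =>
    (hasDerivAt_laguerreNormalDeriv n d (ne_of_gt (hint ht))).const_mul σ
  refine MonotoneOn.convexOn_of_deriv hS (hcont.const_smul σ |>.congr fun t _ => by simp)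
    (fun t ht => (hder t ht).differentiableAt.differentiableWithinAt) ?_
  -- `deriv (σ w) = σ w₁` on the interior, and `σ w₁` is monotone there
  have hmono : MonotoneOn (fun t => σ * laguerreNormalDeriv n d t) (interior S) := by
    refine monotoneOn_of_hasDerivWithinAt_nonneg hS.interior
      (f' := fun t => σ * (-(laguerreNormalQ n d t) * laguerreNormal n d t))
      (fun t ht => (hder2 t ht).continuousAt.continuousWithinAt)
      (fun t ht => ?_) (fun t ht => ?_)
    · rw [interior_interior] at ht
      exact (hder2 t ht).hasDerivWithinAt
    · rw [interior_interior] at ht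
      have := hsign t ht
      nlinarith
  refine hmono.congr fun t ht => ?_
  exact ((hder t ht).deriv).symm

/-! ### The zeros of `w` and the sign pattern on the gaps -/

section Roots

variable {r : Fin d → ℝ}

/-- With `L_d^{(n-1/2)} = ((-1)^d/d!) ∏ (X - rᵢ)`: `w(t) = e^{-t²/2} tⁿ ((-1)^d/d!) ∏ (t² - rᵢ)`.
[cite: Szego1975, (5.1.6)] -/
theorem laguerreNormal_eq_prod
    (hL : laguerre ((n : ℝ) - 1 / 2) d = C ((-1) ^ d / (d ! : ℝ)) * ∏ i, (X - C (r i))) (t : ℝ) :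
    laguerreNormal n d t =
      Real.exp (-(t ^ 2 / 2)) * t ^ n * ((-1) ^ d / (d ! : ℝ) * ∏ i, (t ^ 2 - r i)) := by
  rw [laguerreNormal, hL, eval_mul, eval_C, eval_prod]
  simp

/-- `w` vanishes at `√rᵢ`. [cite: Szego1975, Thm. 3.3.1] -/
theorem laguerreNormal_sqrt_root
    (hL : laguerre ((n : ℝ) - 1 / 2) d = C ((-1) ^ d / (d ! : ℝ)) * ∏ i, (X - C (r i)))
    (hr0 : ∀ i, 0 < r i) (i : Fin d) : laguerreNormal n d (Real.sqrt (r i)) = 0 := by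
  rw [laguerreNormal_eq_prod n d hL, Real.sq_sqrt (hr0 i).le]
  exact mul_eq_zero_of_right _ (mul_eq_zero_of_right _
    (Finset.prod_eq_zero (Finset.mem_univ i) (sub_self _)))

/-- **Sign pattern on the gaps**: if exactly the roots `rᵢ`, `i ≥ j`, lie above `t²` (`t > 0`), then
`(-1)^j w(t) > 0`. [cite: Szego1975, Thm. 3.3.1] -/
theorem laguerreNormal_gap_sign
    (hL : laguerre ((n : ℝ) - 1 / 2) d = C ((-1) ^ d / (d ! : ℝ)) * ∏ i, (X - C (r i)))
    {t : ℝ} (ht : 0 < t) (j : ℕ) (hj : j ≤ d)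
    (hlt : ∀ i : Fin d, (i : ℕ) < j → Real.sqrt (r i) < t)
    (hgt : ∀ i : Fin d, j ≤ (i : ℕ) → t < Real.sqrt (r i)) :
    0 < (-1) ^ j * laguerreNormal n d t := by
  have hlt' : ∀ i : Fin d, (i : ℕ) < j → r i < t ^ 2 := fun i hi =>
    (Real.sqrt_lt' ht).1 (hlt i hi)
  have hgt' : ∀ i : Fin d, j ≤ (i : ℕ) → t ^ 2 < r i := fun i hi =>
    (Real.lt_sqrt ht.le).1 (hgt i hi)
  have hs := Literature.NumberTheory.LFunctions.sign_prod_sub r (t ^ 2) j hj hlt' hgt'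
  rw [laguerreNormal_eq_prod n d hL]
  have hpos : 0 < Real.exp (-(t ^ 2 / 2)) * t ^ n / (d ! : ℝ) := by positivity
  have e : (-1 : ℝ) ^ j * (Real.exp (-(t ^ 2 / 2)) * t ^ n * ((-1) ^ d / (d ! : ℝ) * ∏ i, (t ^ 2 - r i)))
      = (Real.exp (-(t ^ 2 / 2)) * t ^ n / (d ! : ℝ)) * ((-1) ^ (d + j) * ∏ i, (t ^ 2 - r i)) := by
    rw [pow_add]; ring
  rw [e]
  exact mul_pos hpos hs

end Roots

end Literature.Analysis.SpecialFunctions
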